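import Literature.AlgebraicGeometry.Frobenioids.CategoriesFactorization
import Literature.AlgebraicGeometry.Frobenioids.CoproductCompletion
import Literature.AlgebraicGeometry.Frobenioids.ArchimedeanBaseCategory
import Literature.AlgebraicGeometry.Frobenioids.ModelFrobenioidBaseSectionSkeleton
import Mathlib.CategoryTheory.Discrete.Basic
import Mathlib.CategoryTheory.InducedCategory
import Mathlib.CategoryTheory.Limits.Shapes.IsTerminal
import HarnessLib

/-!
# Frobenioids I, §0 ("connected object", "categorical quotient", "mono-minimal categorical quotient") and
# Thm. 5.2 ("skeleton representative"): four VOCABULARY predicates whose universal closures are false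

Mochizuki, *The geometry of Frobenioids I: the general theory*, Kyushu J. Math. **62** (2008) 293–400,
§0, kurims text p. 15 ("connected" objects), p. 18 ("categorical quotient", "mono-minimal") and §5, proof
of Theorem 5.2, p. 102 ("we may assume … that `C` is a skeleton") [cite: MochizukiFrdI2008, §0 pp.15-18].

The four declarations `IsConnectedObj A`, `IsCategoricalQuotient G φ`, `IsMonoMinimalQuotient G φ`
(`Categories.lean`, `CategoriesFactorization.lean`, seat abc-iut-found) and `ModelFrobenioid.IsSkeletonRep A`
(`ModelFrobenioidBaseSectionSkeleton.lean`) are DEFINITIONS of [FrdI] §0 / §5 — `Prop`-valued predicates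
of an object, resp. of an arrow and a group of automorphisms — whose docstrings carry a page locator, so the
cell's frozen FACT-LIST (rows F-0953, F-0969, F-0976, F-2689; class `preparatory`, kernel_closedness
`parametrised`, label «model-witness») lists them among the bindable "published prerequisites".  A predicate
is not a claim: its universal closure says "EVERY object of EVERY category is connected", "EVERY arrow is a
categorical quotient of its domain by EVERY group of automorphisms", "EVERY object is the chosen
representative of its isomorphism class", and is false.  This PROOF-ONLY file (abc-iut cell, block F
fact-proving wave, seat abc-iut-f-012; no definition, no instance) records, per row, the kernel negation of
the universal closure over exactly the declaration's binders (universe level `0`) from a minimal closed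
witness, and cites BY NAME the theorems of the tree in which the predicate is ESTABLISHED for the objects
print applies it to:

* F-0953 `IsConnectedObj` — `not_forall_isConnectedObj`: the unique object of the one-object discrete
  category `Discrete PUnit` is initial, hence not "nonempty" ([FrdI] §0 p. 15: nonempty = non-initial), hence
  not connected (`not_isConnectedObj_discretePUnit`).  Established instances: objects of `C` are connected
  objects of `C^⊥`, `C^⊤` (`isConnectedObj_toFiniteCoproductCompletion`, `…Countable…`, [FrdI] §0 p. 16).
* F-0969 `IsCategoricalQuotient`, F-0976 `IsMonoMinimalQuotient` — `not_forall_isCategoricalQuotient`,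
  `not_forall_isMonoMinimalQuotient`: in `D₀` ([FrdII] §3: `Spec ℝ`, `Spec ℂ`) the identity of `Spec ℂ` is
  NOT a categorical quotient of `Spec ℂ` by `Aut(Spec ℂ) = {1, conj}` (condition (a) `φ ∘ γ = φ` fails at
  `γ = conj`), a fortiori not a mono-minimal one.  Established instances: an isomorphism of a totally
  epimorphic category is a mono-minimal categorical quotient of its domain by the trivial group ([FrdI] §0
  p. 18, `IsTotallyEpimorphic.isMonoMinimalQuotient_bot_of_isIso`; here at `D₀`).
* F-2689 `ModelFrobenioid.IsSkeletonRep` — `not_forall_isSkeletonRep`: in the category induced on `Bool`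
  by the constant map to `Discrete PUnit` the two objects are distinct but isomorphic, so they cannot both
  be the chosen representative of their common class (`IsSkeletonRep.eq_of_iso`).  Established instances:
  every object in the image of `fromSkeleton` is a representative (`ModelFrobenioid.isSkeletonRep_obj`),
  every object is isomorphic to one (`ModelFrobenioid.exists_isSkeletonRep_iso`).

So none of the four rows is an admissible HYPOTHESIS of anything (a consumer that needs "`A` is connected"
for a specific `A` proves it); FACT-LIST class «universal-closure REFUTED; instance forms PROVED».
Elementary category theory; nothing here bears on [IUTchIII] Cor. 3.12 or takes a side; refuted-as-closure
is a statement about OUR typing's binders, not about the paper.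
-/

namespace Literature.AlgebraicGeometry.Frobenioids

open CategoryTheory CategoryTheory.Limits

universe v u

/-! ### F-0953 `IsConnectedObj` ([FrdI] §0 p. 15) -/

/-- The unique object of the one-object discrete category is initial. [cite: MochizukiFrdI2008, §0 p.15] -/
theorem nonempty_isInitial_discretePUnit :
    Nonempty (IsInitial (Discrete.mk PUnit.unit : Discrete PUnit.{1})) :=
  ⟨IsInitial.ofUniqueHom (fun Y => eqToHom (by ext)) fun _ _ => Subsingleton.elim _ _⟩

/-- **Closed witness**: the unique object of `Discrete PUnit` is NOT a connected object — it is initial,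
i.e. not "nonempty" in the sense of [FrdI] §0 p. 15. [cite: MochizukiFrdI2008, §0 p.15] -/
theorem not_isConnectedObj_discretePUnit :
    ¬ IsConnectedObj (Discrete.mk PUnit.unit : Discrete PUnit.{1}) :=
  fun h => h.1.false nonempty_isInitial_discretePUnit.some

/-- **The universal closure of the vocabulary predicate `IsConnectedObj` is FALSE** (FACT-LIST F-0953:
a definition, not a hypothesis).  Binders exactly those of the declaration, universe level `0`.
[cite: MochizukiFrdI2008, §0 p.15] -/
theorem not_forall_isConnectedObj :
    ¬ ∀ (C : Type) [Category.{0} C] (A : C),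
        Literature.AlgebraicGeometry.Frobenioids.IsConnectedObj A :=
  fun h => not_isConnectedObj_discretePUnit (h (Discrete PUnit.{1}) (Discrete.mk PUnit.unit))

/-- **Census of F-0953**: the closure is false, while objects of `C` ARE connected objects of the finite
coproduct completion `C^⊥` ([FrdI] §0 p. 16, `isConnectedObj_toFiniteCoproductCompletion`) — the instance
form print uses. [cite: MochizukiFrdI2008, §0 p.16] -/
theorem isConnectedObj_schema_census {C : Type u} [Category.{v} C] (A : C) :
    (¬ ∀ (C : Type) [Category.{0} C] (A : C),
        Literature.AlgebraicGeometry.Frobenioids.IsConnectedObj A) ∧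
      IsConnectedObj ((toFiniteCoproductCompletion.{0} C).obj A) :=
  ⟨not_forall_isConnectedObj, isConnectedObj_toFiniteCoproductCompletion A⟩

/-! ### F-0969 `IsCategoricalQuotient`, F-0976 `IsMonoMinimalQuotient` ([FrdI] §0 p. 18) -/

/-- **Closed witness**: in `D₀` the identity of `Spec ℂ` is NOT a categorical quotient of `Spec ℂ` by the
full automorphism group `{1, conj}`: condition (a) "`φ ∘ γ = φ` for all `γ ∈ G`" fails at complex
conjugation. [cite: MochizukiFrdI2008, §0 p.18] -/
theorem not_isCategoricalQuotient_top_id_complex :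
    ¬ IsCategoricalQuotient (⊤ : Subgroup (Aut ArchFrd.D0.complex)) (𝟙 ArchFrd.D0.complex) := by
  intro h
  have hγ := h.1 ⟨ArchFrd.D0.conj, ArchFrd.D0.conj, ArchFrd.D0.conj_comp_conj, ArchFrd.D0.conj_comp_conj⟩
    (Subgroup.mem_top _)
  rw [Category.comp_id] at hγ
  exact ArchFrd.D0.conj_ne_id hγ

/-- **Closed witness**: a fortiori that identity is not a mono-minimal categorical quotient by `{1, conj}`.
[cite: MochizukiFrdI2008, §0 p.18] -/
theorem not_isMonoMinimalQuotient_top_id_complex :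
    ¬ IsMonoMinimalQuotient (⊤ : Subgroup (Aut ArchFrd.D0.complex)) (𝟙 ArchFrd.D0.complex) :=
  fun h => not_isCategoricalQuotient_top_id_complex h.1

/-- **The universal closure of the vocabulary predicate `IsCategoricalQuotient` is FALSE** (FACT-LIST
F-0969: a definition, not a hypothesis).  Binders exactly those of the declaration, universe level `0`.
[cite: MochizukiFrdI2008, §0 p.18] -/
theorem not_forall_isCategoricalQuotient :
    ¬ ∀ (C : Type) [Category.{0} C] (A B : C) (G : Subgroup (Aut A)) (φ : A ⟶ B),
        Literature.AlgebraicGeometry.Frobenioids.IsCategoricalQuotient G φ :=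
  fun h => not_isCategoricalQuotient_top_id_complex
    (h ArchFrd.D0 ArchFrd.D0.complex ArchFrd.D0.complex ⊤ (𝟙 ArchFrd.D0.complex))

/-- **The universal closure of the vocabulary predicate `IsMonoMinimalQuotient` is FALSE** (FACT-LIST
F-0976: a definition, not a hypothesis).  Binders exactly those of the declaration, universe level `0`.
[cite: MochizukiFrdI2008, §0 p.18] -/
theorem not_forall_isMonoMinimalQuotient :
    ¬ ∀ (C : Type) [Category.{0} C] (A B : C) (G : Subgroup (Aut A)) (φ : A ⟶ B),
        Literature.AlgebraicGeometry.Frobenioids.IsMonoMinimalQuotient G φ :=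
  fun h => not_isMonoMinimalQuotient_top_id_complex
    (h ArchFrd.D0 ArchFrd.D0.complex ArchFrd.D0.complex ⊤ (𝟙 ArchFrd.D0.complex))

/-- **Census of F-0969 / F-0976**: both closures are false, while print's own instance form holds — "an
isomorphism is always a mono-minimal categorical quotient of its domain by the trivial group" in a totally
epimorphic category ([FrdI] §0 p. 18, `IsTotallyEpimorphic.isMonoMinimalQuotient_bot_of_isIso`), here at
`D₀` (totally epimorphic, `ArchFrd.D0.isTotallyEpimorphic`) for every isomorphism. [cite: MochizukiFrdI2008, §0 p.18] -/
theorem isCategoricalQuotient_schema_census {K L : ArchFrd.D0} (φ : K ⟶ L) [IsIso φ] :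
    (¬ ∀ (C : Type) [Category.{0} C] (A B : C) (G : Subgroup (Aut A)) (φ : A ⟶ B),
        Literature.AlgebraicGeometry.Frobenioids.IsCategoricalQuotient G φ) ∧
      (¬ ∀ (C : Type) [Category.{0} C] (A B : C) (G : Subgroup (Aut A)) (φ : A ⟶ B),
          Literature.AlgebraicGeometry.Frobenioids.IsMonoMinimalQuotient G φ) ∧
        IsMonoMinimalQuotient (⊥ : Subgroup (Aut K)) φ ∧ IsCategoricalQuotient (⊥ : Subgroup (Aut K)) φ :=
  ⟨not_forall_isCategoricalQuotient, not_forall_isMonoMinimalQuotient,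
    ArchFrd.D0.isTotallyEpimorphic.isMonoMinimalQuotient_bot_of_isIso φ,
    (ArchFrd.D0.isTotallyEpimorphic.isMonoMinimalQuotient_bot_of_isIso φ).1⟩

/-! ### F-2689 `ModelFrobenioid.IsSkeletonRep` ([FrdI] Thm. 5.2, proof, p. 102) -/

/-- **Closed witness**: in the category induced on `Bool` by the constant map to the one-object discrete
category (two distinct, isomorphic objects), the objects `true` and `false` are NOT both the chosen
representative of their (common) isomorphism class. [cite: MochizukiFrdI2008, Thm. 5.2 p.102] -/
theorem not_isSkeletonRep_true_and_false :
    ¬ (ModelFrobenioid.IsSkeletonRep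
          (D := InducedCategory (Discrete PUnit.{1}) (fun _ : Bool => Discrete.mk PUnit.unit)) true ∧
        ModelFrobenioid.IsSkeletonRep
          (D := InducedCategory (Discrete PUnit.{1}) (fun _ : Bool => Discrete.mk PUnit.unit)) false) := by
  rintro ⟨ht, hf⟩
  have e : @Iso (InducedCategory (Discrete PUnit.{1}) (fun _ : Bool => Discrete.mk PUnit.unit)) _
      true false :=
    InducedCategory.isoMk (Iso.refl _)
  exact Bool.noConfusion (ht.eq_of_iso hf e)

/-- **The universal closure of the vocabulary predicate `ModelFrobenioid.IsSkeletonRep` is FALSE**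
(FACT-LIST F-2689: a definition, not a hypothesis).  Binders exactly those of the declaration, universe
level `0`. [cite: MochizukiFrdI2008, Thm. 5.2 p.102] -/
theorem not_forall_isSkeletonRep :
    ¬ ∀ (D : Type) [Category.{0} D] (A : D),
        Literature.AlgebraicGeometry.Frobenioids.ModelFrobenioid.IsSkeletonRep A :=
  fun h => not_isSkeletonRep_true_and_false
    ⟨h (InducedCategory (Discrete PUnit.{1}) (fun _ : Bool => Discrete.mk PUnit.unit)) true,
      h (InducedCategory (Discrete PUnit.{1}) (fun _ : Bool => Discrete.mk PUnit.unit)) false⟩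

/-- **Census of F-2689**: the closure is false, while the instance forms print uses hold in every category —
images of `fromSkeleton` are representatives and every object is isomorphic to a representative
(`ModelFrobenioid.isSkeletonRep_obj`, `ModelFrobenioid.exists_isSkeletonRep_iso`).
[cite: MochizukiFrdI2008, Thm. 5.2 p.102] -/
theorem isSkeletonRep_schema_census {D : Type u} [Category.{v} D] (X : Skeleton D) (A₀ : D) :
    (¬ ∀ (D : Type) [Category.{0} D] (A : D),
        Literature.AlgebraicGeometry.Frobenioids.ModelFrobenioid.IsSkeletonRep A) ∧
      ModelFrobenioid.IsSkeletonRep ((fromSkeleton D).obj X) ∧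
        ∃ A : D, ModelFrobenioid.IsSkeletonRep A ∧ Nonempty (A ≅ A₀) :=
  ⟨not_forall_isSkeletonRep, ModelFrobenioid.isSkeletonRep_obj X,
    ModelFrobenioid.exists_isSkeletonRep_iso A₀⟩

end Literature.AlgebraicGeometry.Frobenioids
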